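import Summits.BirchSwinnertonDyer.BirchSwinnertonDyer.Theorems.EisensteinPrimesMazurMCOnCellBKatopointFactorisation
import HarnessLib

/-!
# Crux 3 `MazurMCOnCellB` (stmt-BirchSwinnertonDyer-19033), line `katopoint` — THE CONVERSE OF THE FACTORISATION:
# granted the exceptional Rubin formula (R), Perrin-Riou up to a unit (PR) ⟺ the typed exceptional leading term ⟺
# `BSD(E,p)` under Mazur's MC at a SPLIT multiplicative pair (Burns–Kurihara–Sano Thm. 7.3 shape, tree currency)

Width seat bsd-line-x2-p1-w5 g2 (2026-08-28); sequel of `Theorems/EisensteinPrimesMazurMCOnCellBKatopointFactorisation.lean`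
(§1–§4: (R) ∧ (PR) ⟹ excLT, v5's road stub 5 by its statement, the katopoint compositions). HONEST FRAMING (cell
`bsd-eis`, run/shared/lean/pub/bsd-eis/): bookkeeping THEOREMS ONLY (no `def`, no named fact introduced, no `sorry`);
`--supports` stmt-BirchSwinnertonDyer-19033; closes no registered stub; no summit statement, no Mazur main conjecture,
no case of BSD, neither (R) nor (PR) nor Schneider is proved for any curve; 0 cells / labels / tiers move.

WHY. The line card `Cruxes/MazurMCOnCellB/Lines/katopoint.md` (bsd-idea-12 g10, rev 1.1) states — in prose — that its
open stub (PR) `Rank1Residual.Additive.PerrinRiouUpToUnitAt Kato2004.PRRatio V ℓ` is of EQUAL logical strength with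
`twistback`'s road stub 5 (the typed exceptional leading term `X2.O9.ExceptionalLeadingTermAt`) and, under
Greenberg–Vatsal's MC and Schneider, with `BSD(V,ℓ)` («TRUTH-VALUE HONESTY … (PR) ⟺ excLT ⟺ BSD_ℓ, BKS Thm. 7.3
shape»). This file is that sentence in the kernel, so that a LEAD weighing a v6 split of stub 5 into (R) × (PR) sees
exactly what is re-currencied and what is not: granted (R) at the pair (hypothesis `hRub`, the EXPANDED form of
`ExcRubinFormulaAt W p` of `Theorems/EisensteinPrimesMazurMCOnCellBKatopointDefs.lean` — definitionally equal, fed by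
`exact`), Schneider at THE §4.2 height, and ONE non-zero Perrin-Riou ratio of Kato's zeta element (Burns–Kurihara–Sano
Conj. 2.8 (i) / Hyp. 2.2 — a hypothesis `hZ`), the three statements coincide at every split multiplicative pair of
analytic rank one, `p ≠ 2`.

* `exists_rat_leadingLCoeff_div_eq_of_GZ` — `L′/(Ω·Reg) ∈ ℚ^×` in the shape of the node (PR) (Gross–Zagier + GZK).
* `valuation_eq_of_rubinIdentity_of_certificate` — the valuation algebra: (R)-identity + L3 certificate ⟹ `v ℒ = v q`.
* `coeffTwo_term_ne_zero` — `ϖ·[T²]L·log_p(γ)² ≠ 0` from `ord = 2`, `Ω⁺_f > 0`, `p ≠ 2`.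
* `prRatio_valuation_eq_of_excRubin_of_exceptionalLeadingTermAt` — (R) + excLT at ONE datum with `Reg_p ≠ 0` ⟹
  `v_p ℒ = v_p(L′/ΩReg)` for EVERY ratio `ℒ ≠ 0`.
* `perrinRiouUpToUnitAt_of_excRubin_of_exceptionalLeadingTermAt` — excLT ⟹ (PR) (data from the tree's existence
  theorems; Schneider; `hZ`).
* `perrinRiouUpToUnitAt_iff_exceptionalLeadingTermAt_of_excRubin` — **(PR) ⟺ excLT** granted (R).
* `perrinRiouUpToUnitAt_iff_bsdp_of_excRubin_of_mazurMainConjectureAt` — **(PR) ⟺ `BSD(E,p)`** under Mazur's MC at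
  the pair, granted (R) (via `X2.certificate_iff_schneider_and_bsdp_of_mazurMainConjectureAt_split`, Jones `hJs`).

References: [BurnsKuriharaSano2019] Conj. 2.8 (p. 10), Hyp. 2.2 (p. 9), Thm. 1.4 (p. 4), Thm. 7.3 (p. 29);
[MazurTateTeitelbaum1986Invent] §I.13, §II.10; [SteinWuthrich2013] §4.2, Thm. 6.1; [Miller2011LMS] Def. 1.1, Prop. 7.6;
[GrossZagier1986] Thm. I.(7.3); [Schneider1985] §1; [Washington1997] §13.1; [Kato2004Asterisque] Thm. 12.5, 16.6.
-/

set_option autoImplicit false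

-- `Summit.BirchSwinnertonDyer.BirchSwinnertonDyer.…`: the summit and its single sub-problem share a name.
set_option linter.dupNamespace false

noncomputable section

open scoped Classical MatrixGroups ModularForm

open PowerSeries CongruenceSubgroup WeierstrassCurve NumberField
  Literature.NumberTheory.EllipticCurves
  Literature.NumberTheory.EllipticCurves.ModularForms
  Literature.NumberTheory.QuadraticFields
  Literature.NumberTheory.EllipticCurves.Rank1Residual
  Literature.NumberTheory.EllipticCurves.Rank1Residual.Typed
  Literature.NumberTheory.EllipticCurves.Wuthrich2014
  Literature.NumberTheory.EllipticCurves.SteinWuthrich2013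
  Literature.NumberTheory.EllipticCurves.GreenbergVatsal2000
  Literature.NumberTheory.EllipticCurves.Disegni2020
  Summit.BirchSwinnertonDyer.Rank1Residual
  Summit.BirchSwinnertonDyer.BirchSwinnertonDyer.Theses
  Summit.BirchSwinnertonDyer.BirchSwinnertonDyer.Theorems
  Summit.BirchSwinnertonDyer.BirchSwinnertonDyer.Theorems.EisensteinPrimesMazurMCOnCellBKatopointFactorisation

namespace Summit.BirchSwinnertonDyer.BirchSwinnertonDyer.Theorems.EisensteinPrimesMazurMCOnCellBKatopointEquivalence

/-! ## §5. THE CONVERSE — granted (R): (PR) ⟺ excLT ⟺ `BSD(E,p)` at the pair («equal strength» in the kernel) -/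

/-- **`L′/(Ω·Reg) ∈ ℚ^×` at analytic rank one, in the shape of the node (PR)** (Gross–Zagier I.(7.3) + GZK).
Bookkeeping. [cite: GrossZagier1986, Thm. I.(7.3) 2)] -/
theorem exists_rat_leadingLCoeff_div_eq_of_GZ (hGZ : GrossZagier1986_thm_I_7_3)
    (hGZK : rank_eq_analyticRank_of_analyticRank_le_one)
    (W : WeierstrassCurve ℚ) [W.IsElliptic] [W.IsGloballyMinimal] (hr : W.analyticRank = 1) :
    ∃ q : ℚ, q ≠ 0 ∧ W.leadingLCoeff / ((W.realPeriodRat : ℂ) * (W.regulator : ℂ)) = (q : ℂ) := by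
  have hrk : W.mordellWeilRank = 1 := by rw [(hGZK W hr.le).1, hr]
  obtain ⟨c, hc0, hc⟩ := leadingLCoeff_eq_rat_mul_of_analyticRank_eq_one (W := W) hGZ hr hrk
  refine ⟨c, hc0, ?_⟩
  have hΩ : (W.realPeriodRat : ℂ) ≠ 0 := by exact_mod_cast W.realPeriodRat_pos_holds.ne'
  have hR : (W.regulator : ℂ) ≠ 0 := by exact_mod_cast W.regulator_pos'.ne'
  rw [hc, div_eq_iff (mul_ne_zero hΩ hR)]
  push_cast
  ring

/-- **The algebra of the converse, at ONE datum**: the (R)-identity `v(ϖ·[T²]L·log²) = v(𝓛·Reg·ℒ)`, the excLT identity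
`v(ϖ·[T²]L·log²·#tors²) = v(𝓛·∏c·Reg) + v s` and §1's `v s = v q + 2 v #tors − v ∏c` force `v ℒ = v q`, as soon as
`ϖ·[T²]L·log² ≠ 0`, `Reg ≠ 0`, `ℒ ≠ 0` (`𝓛_p ≠ 0` is the tree's theorem). Pure valuation bookkeeping. [folklore]
[cite: BurnsKuriharaSano2019, Thm. 7.3 (p. 29) (the «any two give the third» shape)] -/
theorem valuation_eq_of_rubinIdentity_of_certificate
    (W : WeierstrassCurve ℚ) [W.IsElliptic] [W.IsGloballyMinimal] (p : ℕ) [Fact p.Prime]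
    {X : ℚ_[p]} (hx0 : X ≠ 0) (Dq : TateParameterData W p) {Dh : PAdicHeightData W p}
    (hReg : padicRegulator Dh ≠ 0) {ℒ : ℚ_[p]} (hℒ0 : ℒ ≠ 0) {q s : ℚ}
    (hval : X.valuation = (LInvariant Dq * padicRegulator Dh * ℒ).valuation)
    (hexc : (X * (W.torsionOrder : ℚ_[p]) ^ 2).valuation =
      (LInvariant Dq * (W.tamagawaProduct : ℚ_[p]) * padicRegulator Dh).valuation + padicValRat p s)
    (hvs : padicValRat p s =
      padicValRat p q + 2 * (padicValNat p W.torsionOrder : ℤ) - (padicValNat p W.tamagawaProduct : ℤ)) :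
    ℒ.valuation = padicValRat p q := by
  have hc0 : 0 < W.tamagawaProduct := W.tamagawaProduct_pos_holds
  have ht0 : 0 < W.torsionOrder := W.torsionOrder_pos_holds
  have htQ : (W.torsionOrder : ℚ_[p]) ≠ 0 := by exact_mod_cast ht0.ne'
  have hcQ : (W.tamagawaProduct : ℚ_[p]) ≠ 0 := by exact_mod_cast hc0.ne'
  have h𝓛 : LInvariant Dq ≠ 0 := (LInvariant_ne_zero_holds (W := W) (p := p)) Dq
  have lhs : (X * (W.torsionOrder : ℚ_[p]) ^ 2).valuation =
      X.valuation + 2 * (padicValNat p W.torsionOrder : ℤ) := by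
    rw [Padic.valuation_mul hx0 (pow_ne_zero 2 htQ), Padic.valuation_pow, Padic.valuation_natCast]
    push_cast
    ring
  have rhs : (LInvariant Dq * (W.tamagawaProduct : ℚ_[p]) * padicRegulator Dh).valuation =
      (LInvariant Dq * padicRegulator Dh).valuation + (padicValNat p W.tamagawaProduct : ℤ) := by
    have e : LInvariant Dq * (W.tamagawaProduct : ℚ_[p]) * padicRegulator Dh =
        (LInvariant Dq * padicRegulator Dh) * (W.tamagawaProduct : ℚ_[p]) := by ring
    rw [e, Padic.valuation_mul (mul_ne_zero h𝓛 hReg) hcQ, Padic.valuation_natCast]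
  have mid : (LInvariant Dq * padicRegulator Dh * ℒ).valuation =
      (LInvariant Dq * padicRegulator Dh).valuation + ℒ.valuation := by
    rw [Padic.valuation_mul (mul_ne_zero h𝓛 hReg) hℒ0]
  rw [lhs, hval, mid, rhs, hvs] at hexc
  linarith

/-- **`ϖ·[T²]L·log_p(γ_cyc)² ≠ 0`** when `ϖ·Ω_W = Ω⁺_f` (so `ϖ ≠ 0` by `Ω⁺_f > 0`), `ord_{T=0} L = 2` and `p ≠ 2`
(`log_p(1+p) ∈ p·ℤ_p^×`, Iwasawa). Bookkeeping. [folklore] [cite: Washington1997, §13.1] -/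
theorem coeffTwo_term_ne_zero (W : WeierstrassCurve ℚ) [W.IsElliptic] (p : ℕ) [Fact p.Prime] (hp2 : p ≠ 2)
    {N : ℕ} [NeZero N] {f : CuspForm (Gamma0 N) 2} (hf : IsNewformOf W f)
    {ϖ : ℚ} (hϖ : (ϖ : ℝ) * W.realPeriodRat = plusPeriod f) {L : PowerSeries ℚ_[p]}
    (hord : L.order = ((2 : ℕ) : ℕ∞)) :
    ((ϖ : ℚ) : ℚ_[p]) * PowerSeries.coeff 2 L * padicLog p (cyclotomicGenerator p) ^ 2 ≠ 0 := by
  have hp : p.Prime := Fact.out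
  have hpQ : (p : ℚ_[p]) ≠ 0 := by exact_mod_cast hp.ne_zero
  have hϖ0 : ((ϖ : ℚ) : ℚ_[p]) ≠ 0 := by
    have hϖ' : ϖ ≠ 0 := by
      intro hz
      rw [hz, Rat.cast_zero, zero_mul] at hϖ
      exact (IsNewform0.plusPeriod_pos_holds hf.1 hf.coeffField_eq_bot).ne' hϖ.symm
    exact_mod_cast hϖ'
  have hc2 : PowerSeries.coeff 2 L ≠ 0 := (PowerSeries.order_eq_nat.mp hord).1
  obtain ⟨w, hw⟩ := exists_unit_padicLog_cyclotomicGenerator (p := p) hp2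
  have hw0 : ((w : ℤ_[p]) : ℚ_[p]) ≠ 0 := by
    rw [Ne, PadicInt.coe_eq_zero]; exact w.ne_zero
  have hlog0 : padicLog p (cyclotomicGenerator p : ℚ_[p]) ≠ 0 := by
    rw [hw]; exact mul_ne_zero hpQ hw0
  exact mul_ne_zero (mul_ne_zero hϖ0 hc2) (pow_ne_zero 2 hlog0)

/-- **(R) + excLT at ONE datum with `Reg_p ≠ 0` pin the valuation of EVERY non-zero Perrin-Riou ratio**: if the
exceptional Rubin formula (R, expanded) and the typed exceptional leading term `X2.O9.ExceptionalLeadingTermAt W p`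
both hold, then at any cyclotomic datum, newform, period ratio, split MTT function, Tate-parameter datum and §4.2 height
with `Reg_p(Dh) ≠ 0`, for `L^{(r)}/(r!·Ω·Reg) = q` and `#Ш_an = s`: every ratio `ℒ ≠ 0` with `Kato2004.PRRatio W p ℒ`
has `v_p ℒ = v_p q` — i.e. Perrin-Riou's formula up to a `p`-adic unit. (R) and excLT are hypotheses.
[cite: BurnsKuriharaSano2019, Conj. 2.8 (ii) (p. 10) and Thm. 7.3 (p. 29)] [cite: MazurTateTeitelbaum1986Invent, §II.10]
[cite: Miller2011LMS, Def. 1.1] -/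
theorem prRatio_valuation_eq_of_excRubin_of_exceptionalLeadingTermAt
    (W : WeierstrassCurve ℚ) [W.IsElliptic] [W.IsGloballyMinimal] (p : ℕ) [Fact p.Prime]
    (hp2 : p ≠ 2) (hL : W.leadingLCoeff ≠ 0)
    (hRub : ∀ (ℒ : ℚ_[p]), Kato2004.PRRatio W p ℒ →
      ∀ (κ : ZpExtension ℚ p) (γ : Field.absoluteGaloisGroup ℚ),
          κ.IsCyclotomic → κ.IsTopGenerator γ → IsCyclotomicVariable p γ →
        ∀ ⦃N : ℕ⦄ [NeZero N] (f : CuspForm (Gamma0 N) 2), IsNewformOf W f →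
        ∀ (ϖ : ℚ), (ϖ : ℝ) * W.realPeriodRat = plusPeriod f →
        ∀ (L : PowerSeries ℚ_[p]), IsSplitMultPAdicLFunctionOf f p L →
        ∀ (Dq : TateParameterData W p) (Dh : PAdicHeightData W p), IsSplitMultCanonical Dh Dq →
          padicRegulator Dh ≠ 0 → ℒ ≠ 0 →
            L.order = ((2 : ℕ) : ℕ∞) ∧
            (((ϖ : ℚ) : ℚ_[p]) * PowerSeries.coeff 2 L * padicLog p (cyclotomicGenerator p) ^ 2).valuation =
              (LInvariant Dq * padicRegulator Dh * ℒ).valuation)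
    (hExc : X2.O9.ExceptionalLeadingTermAt W p)
    {κ : ZpExtension ℚ p} {γ : Field.absoluteGaloisGroup ℚ} (hκ : κ.IsCyclotomic) (hγ : κ.IsTopGenerator γ)
    (hγ' : IsCyclotomicVariable p γ) {N : ℕ} [NeZero N] {f : CuspForm (Gamma0 N) 2} (hf : IsNewformOf W f)
    {ϖ : ℚ} (hϖ : (ϖ : ℝ) * W.realPeriodRat = plusPeriod f)
    {L : PowerSeries ℚ_[p]} (hL' : IsSplitMultPAdicLFunctionOf f p L)
    (Dq : TateParameterData W p) {Dh : PAdicHeightData W p} (hDh : IsSplitMultCanonical Dh Dq)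
    (hReg : padicRegulator Dh ≠ 0) {q s : ℚ}
    (hq : W.leadingLCoeff / ((W.realPeriodRat : ℂ) * (W.regulator : ℂ)) = (q : ℂ)) (hs : shaAn W = (s : ℂ))
    {ℒ : ℚ_[p]} (hℒ : Kato2004.PRRatio W p ℒ) (hℒ0 : ℒ ≠ 0) :
    ℒ.valuation = padicValRat p q := by
  obtain ⟨hord, hval⟩ := hRub ℒ hℒ κ γ hκ hγ hγ' f hf ϖ hϖ L hL' Dq Dh hDh hReg hℒ0
  obtain ⟨-, hexc⟩ := hExc κ γ hκ hγ hγ' f hf ϖ hϖ L hL' Dq Dh hDh s hs hReg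
  obtain ⟨-, hvs⟩ := padicValRat_shaAn_eq W p hL hq hs
  have hx0 := coeffTwo_term_ne_zero W p hp2 hf hϖ hord
  have hexc' : (((ϖ : ℚ) : ℚ_[p]) * PowerSeries.coeff 2 L * padicLog p (cyclotomicGenerator p) ^ 2 *
      (W.torsionOrder : ℚ_[p]) ^ 2).valuation =
      (LInvariant Dq * (W.tamagawaProduct : ℚ_[p]) * padicRegulator Dh).valuation + padicValRat p s := by
    rw [← hexc]; ring_nf
  exact valuation_eq_of_rubinIdentity_of_certificate W p hx0 Dq hReg hℒ0 hval hexc' hvs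

/-- **excLT ⟹ (PR), granted (R), Schneider at the canonical height and ONE non-zero Perrin-Riou ratio** — at a pair
with `p ≠ 2` SPLIT multiplicative: the data at which both statements are instantiated EXIST by the tree's theorems
(`exists_isCyclotomic_isTopGenerator_isCyclotomicVariable_holds`; the modular parametrisation `hpar` with its newform and
period ratio; `exists_isSplitMultPAdicLFunctionOf`; `nonempty_tateParameterData_iff_holds`; the §4.2 height `hHs`;
`#Ш_an ∈ ℚ` and `L′/(ΩReg) ∈ ℚ^×` by Gross–Zagier + GZK), Schneider supplies `Reg_p ≠ 0`, and
`prRatio_valuation_eq_of_excRubin_of_exceptionalLeadingTermAt` reads off `v_p ℒ`. The realisability-with-non-vanishing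
input `hZ` («Kato's zeta element has SOME ratio `ℒ ≠ 0`», Burns–Kurihara–Sano Conj. 2.8 (i) / Hyp. 2.2) is a
hypothesis, as are (R), excLT and Schneider. [cite: BurnsKuriharaSano2019, Conj. 2.8 (p. 10), Hyp. 2.2 (p. 9), Thm. 7.3 (p. 29)]
[cite: SteinWuthrich2013, §4.2 and Thm. 6.1] [cite: Schneider1985, §1 (hypothesis)] [cite: GrossZagier1986, Thm. I.(7.3) 2)] -/
theorem perrinRiouUpToUnitAt_of_excRubin_of_exceptionalLeadingTermAt
    (hHs : exists_isSplitMultCanonical) (hGZ : GrossZagier1986_thm_I_7_3)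
    (hGZK : rank_eq_analyticRank_of_analyticRank_le_one) (hpar : nonempty_modularParametrizationData)
    (W : WeierstrassCurve ℚ) [W.IsElliptic] [W.IsGloballyMinimal] (p : ℕ) [Fact p.Prime]
    (hp2 : p ≠ 2) (hsplit : W.HasSplitMultiplicativeReductionAtPrime p)
    (hRub : ∀ (ℒ : ℚ_[p]), Kato2004.PRRatio W p ℒ →
      ∀ (κ : ZpExtension ℚ p) (γ : Field.absoluteGaloisGroup ℚ),
          κ.IsCyclotomic → κ.IsTopGenerator γ → IsCyclotomicVariable p γ →
        ∀ ⦃N : ℕ⦄ [NeZero N] (f : CuspForm (Gamma0 N) 2), IsNewformOf W f →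
        ∀ (ϖ : ℚ), (ϖ : ℝ) * W.realPeriodRat = plusPeriod f →
        ∀ (L : PowerSeries ℚ_[p]), IsSplitMultPAdicLFunctionOf f p L →
        ∀ (Dq : TateParameterData W p) (Dh : PAdicHeightData W p), IsSplitMultCanonical Dh Dq →
          padicRegulator Dh ≠ 0 → ℒ ≠ 0 →
            L.order = ((2 : ℕ) : ℕ∞) ∧
            (((ϖ : ℚ) : ℚ_[p]) * PowerSeries.coeff 2 L * padicLog p (cyclotomicGenerator p) ^ 2).valuation =
              (LInvariant Dq * padicRegulator Dh * ℒ).valuation)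
    (hExc : X2.O9.ExceptionalLeadingTermAt W p)
    (hSch : ∀ (Dq : TateParameterData W p) (Dh : PAdicHeightData W p),
      IsSplitMultCanonical Dh Dq → SchneiderConjecture Dh)
    (hZ : W.analyticRank = 1 → ∃ ℒ : ℚ_[p], Kato2004.PRRatio W p ℒ ∧ ℒ ≠ 0) :
    Additive.PerrinRiouUpToUnitAt Kato2004.PRRatio W p := by
  intro hr1
  obtain ⟨ℒ, hℒ, hℒ0⟩ := hZ hr1
  obtain ⟨κ, hκ, γ, hγ, hγ'⟩ := exists_isCyclotomic_isTopGenerator_isCyclotomicVariable_holds p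
  haveI : NeZero (W.conductorNorm ℤ) := ⟨(W.conductorNorm_pos_holds).ne'⟩
  obtain ⟨Dm⟩ := hpar W
  obtain ⟨ϖ, -, hϖ, -⟩ := Dm.exists_rat_mul_realPeriodRat_eq_plusPeriod
  obtain ⟨L, hL⟩ := exists_isSplitMultPAdicLFunctionOf hsplit Dm.isNewformOf
  obtain ⟨Dq⟩ := (nonempty_tateParameterData_iff_holds (W := W) (p := p)).mpr hsplit
  obtain ⟨Dh, hDh⟩ := hHs W p hp2 Dq
  obtain ⟨s, hs⟩ := X2.exists_rat_shaAn_eq_of_analyticRank_eq_one hGZ hGZK W hr1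
  obtain ⟨q, -, hq⟩ := exists_rat_leadingLCoeff_div_eq_of_GZ hGZ hGZK W hr1
  have hReg : padicRegulator Dh ≠ 0 := hSch Dq Dh hDh
  exact ⟨ℒ, hℒ, hℒ0, q, hq, prRatio_valuation_eq_of_excRubin_of_exceptionalLeadingTermAt W p hp2
    (leadingLCoeff_ne_zero_of_GZ hGZ hGZK W hr1) hRub hExc hκ hγ hγ' Dm.isNewformOf hϖ hL Dq hDh hReg hq hs hℒ hℒ0⟩

/-- **Granted (R): (PR) ⟺ excLT at a split multiplicative pair of analytic rank one** (`p ≠ 2`; Schneider at the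
canonical height; one non-zero Perrin-Riou ratio; the tree's existence theorems and Gross–Zagier/GZK as inputs). The
forward direction is §2, the backward direction the previous theorem. This is the kernel form of the line card's
sentence «the line RE-CURRENCIES the split residue, it does not shrink its logical strength»: with (R) in hand, the
katopoint stub (PR) and `twistback`'s road stub 5 (excLT) are the SAME open problem at each pair.
[cite: BurnsKuriharaSano2019, Conj. 2.8 (p. 10) and Thm. 7.3 (p. 29)] [cite: MazurTateTeitelbaum1986Invent, §II.10] -/
theorem perrinRiouUpToUnitAt_iff_exceptionalLeadingTermAt_of_excRubin
    (hHs : exists_isSplitMultCanonical) (hGZ : GrossZagier1986_thm_I_7_3)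
    (hGZK : rank_eq_analyticRank_of_analyticRank_le_one) (hpar : nonempty_modularParametrizationData)
    (W : WeierstrassCurve ℚ) [W.IsElliptic] [W.IsGloballyMinimal] (p : ℕ) [Fact p.Prime]
    (hr1 : W.analyticRank = 1) (hp2 : p ≠ 2) (hsplit : W.HasSplitMultiplicativeReductionAtPrime p)
    (hRub : ∀ (ℒ : ℚ_[p]), Kato2004.PRRatio W p ℒ →
      ∀ (κ : ZpExtension ℚ p) (γ : Field.absoluteGaloisGroup ℚ),
          κ.IsCyclotomic → κ.IsTopGenerator γ → IsCyclotomicVariable p γ →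
        ∀ ⦃N : ℕ⦄ [NeZero N] (f : CuspForm (Gamma0 N) 2), IsNewformOf W f →
        ∀ (ϖ : ℚ), (ϖ : ℝ) * W.realPeriodRat = plusPeriod f →
        ∀ (L : PowerSeries ℚ_[p]), IsSplitMultPAdicLFunctionOf f p L →
        ∀ (Dq : TateParameterData W p) (Dh : PAdicHeightData W p), IsSplitMultCanonical Dh Dq →
          padicRegulator Dh ≠ 0 → ℒ ≠ 0 →
            L.order = ((2 : ℕ) : ℕ∞) ∧
            (((ϖ : ℚ) : ℚ_[p]) * PowerSeries.coeff 2 L * padicLog p (cyclotomicGenerator p) ^ 2).valuation =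
              (LInvariant Dq * padicRegulator Dh * ℒ).valuation)
    (hSch : ∀ (Dq : TateParameterData W p) (Dh : PAdicHeightData W p),
      IsSplitMultCanonical Dh Dq → SchneiderConjecture Dh)
    (hZ : ∃ ℒ : ℚ_[p], Kato2004.PRRatio W p ℒ ∧ ℒ ≠ 0) :
    Additive.PerrinRiouUpToUnitAt Kato2004.PRRatio W p ↔ X2.O9.ExceptionalLeadingTermAt W p :=
  ⟨fun hPR ↦ exceptionalLeadingTermAt_of_excRubin_of_perrinRiou W p hr1 hp2
      (leadingLCoeff_ne_zero_of_GZ hGZ hGZK W hr1) hRub hPR,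
    fun hExc ↦ perrinRiouUpToUnitAt_of_excRubin_of_exceptionalLeadingTermAt hHs hGZ hGZK hpar W p hp2 hsplit hRub
      hExc hSch (fun _ ↦ hZ)⟩

/-- **Burns–Kurihara–Sano Thm. 7.3 shape at a SPLIT MULTIPLICATIVE pair, in the tree's currency: under Mazur's main
conjecture at the pair and (R), Perrin-Riou up to a unit ⟺ `BSD(E,p)`** (analytic rank one, `p ≠ 2`; Schneider at the
canonical height; one non-zero ratio; Jones's two-variable input `hJs`, the height `hHs`, Gross–Zagier/GZK and the
parametrisation as named inputs). (→): §2 gives excLT, whose instance at the existing data is the L3 certificate, which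
under the MC is `Schneider ∧ BSD(E,p)` (`X2.certificate_iff_schneider_and_bsdp_of_mazurMainConjectureAt_split`).
(←): the same `iff` backwards yields the certificate at the data, and `valuation_eq_of_rubinIdentity_of_certificate`
with (R) reads off `v_p ℒ`. On the Greenberg–Vatsal half the MC is the route's published input, so there (PR) — the
katopoint line's open stub — is EXACTLY `BSD(E,p)` granted (R) and Schneider: a re-currencying, not a weakening, as
the line card says. Nothing is proved about MC, (R), (PR), Schneider or BSD. [cite: BurnsKuriharaSano2019, Thm. 7.3 (p. 29)]
[cite: SteinWuthrich2013, Thm. 6.1 (p. 20) and §4.2] [cite: Miller2011LMS, Def. 1.1 and Prop. 7.6]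
[cite: MazurTateTeitelbaum1986Invent, §II.10] -/
theorem perrinRiouUpToUnitAt_iff_bsdp_of_excRubin_of_mazurMainConjectureAt
    (hJs : thm61_splitMultiplicative) (hHs : exists_isSplitMultCanonical) (hGZ : GrossZagier1986_thm_I_7_3)
    (hGZK : rank_eq_analyticRank_of_analyticRank_le_one) (hpar : nonempty_modularParametrizationData)
    (W : WeierstrassCurve ℚ) [W.IsElliptic] [W.IsGloballyMinimal] (p : ℕ) [Fact p.Prime]
    (hr1 : W.analyticRank = 1) (hp2 : p ≠ 2) (hsplit : W.HasSplitMultiplicativeReductionAtPrime p)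
    (hMC : X2.MazurMainConjectureAt W p)
    (hRub : ∀ (ℒ : ℚ_[p]), Kato2004.PRRatio W p ℒ →
      ∀ (κ : ZpExtension ℚ p) (γ : Field.absoluteGaloisGroup ℚ),
          κ.IsCyclotomic → κ.IsTopGenerator γ → IsCyclotomicVariable p γ →
        ∀ ⦃N : ℕ⦄ [NeZero N] (f : CuspForm (Gamma0 N) 2), IsNewformOf W f →
        ∀ (ϖ : ℚ), (ϖ : ℝ) * W.realPeriodRat = plusPeriod f →
        ∀ (L : PowerSeries ℚ_[p]), IsSplitMultPAdicLFunctionOf f p L →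
        ∀ (Dq : TateParameterData W p) (Dh : PAdicHeightData W p), IsSplitMultCanonical Dh Dq →
          padicRegulator Dh ≠ 0 → ℒ ≠ 0 →
            L.order = ((2 : ℕ) : ℕ∞) ∧
            (((ϖ : ℚ) : ℚ_[p]) * PowerSeries.coeff 2 L * padicLog p (cyclotomicGenerator p) ^ 2).valuation =
              (LInvariant Dq * padicRegulator Dh * ℒ).valuation)
    (hSch : ∀ (Dq : TateParameterData W p) (Dh : PAdicHeightData W p),
      IsSplitMultCanonical Dh Dq → SchneiderConjecture Dh)
    (hZ : ∃ ℒ : ℚ_[p], Kato2004.PRRatio W p ℒ ∧ ℒ ≠ 0) :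
    Additive.PerrinRiouUpToUnitAt Kato2004.PRRatio W p ↔ BSDp W p := by
  -- the data, once
  obtain ⟨κ, hκ, γ, hγ, hγ'⟩ := exists_isCyclotomic_isTopGenerator_isCyclotomicVariable_holds p
  obtain ⟨D⟩ := W.nonempty_selmerDualData_holds κ γ hγ
  haveI : NeZero (W.conductorNorm ℤ) := ⟨(W.conductorNorm_pos_holds).ne'⟩
  obtain ⟨Dm⟩ := hpar W
  obtain ⟨ϖ, hϖpos, hϖ, -⟩ := Dm.exists_rat_mul_realPeriodRat_eq_plusPeriod
  obtain ⟨L, hL⟩ := exists_isSplitMultPAdicLFunctionOf hsplit Dm.isNewformOf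
  obtain ⟨Dq⟩ := (nonempty_tateParameterData_iff_holds (W := W) (p := p)).mpr hsplit
  obtain ⟨Dh, hDh⟩ := hHs W p hp2 Dq
  obtain ⟨s, hs⟩ := X2.exists_rat_shaAn_eq_of_analyticRank_eq_one hGZ hGZK W hr1
  obtain ⟨q, -, hq⟩ := exists_rat_leadingLCoeff_div_eq_of_GZ hGZ hGZK W hr1
  have hrank : W.mordellWeilRank = 1 := by rw [(hGZK W hr1.le).1, hr1]
  have hReg : padicRegulator Dh ≠ 0 := hSch Dq Dh hDh
  have hLc : W.leadingLCoeff ≠ 0 := leadingLCoeff_ne_zero_of_GZ hGZ hGZK W hr1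
  have hcert := X2.certificate_iff_schneider_and_bsdp_of_mazurMainConjectureAt_split hJs hGZK W p hp2 hr1.le hMC
    Dq hDh hκ hγ hγ' Dm.isNewformOf D ϖ hϖpos.ne' hϖ L hL hs
  rw [hrank] at hcert
  constructor
  · intro hPR
    have hExc := exceptionalLeadingTermAt_of_excRubin_of_perrinRiou W p hr1 hp2 hLc hRub hPR
    obtain ⟨hord, hval⟩ := hExc κ γ hκ hγ hγ' Dm.f Dm.isNewformOf ϖ hϖ L hL Dq Dh hDh s hs hReg
    exact (hcert.mp ⟨hord, hval⟩).2
  · intro hB hr1'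
    obtain ⟨ℒ, hℒ, hℒ0⟩ := hZ
    obtain ⟨hord, hexc⟩ := hcert.mpr ⟨hSch Dq Dh hDh, hB⟩
    obtain ⟨-, hval⟩ := hRub ℒ hℒ κ γ hκ hγ hγ' Dm.f Dm.isNewformOf ϖ hϖ L hL Dq Dh hDh hReg hℒ0
    obtain ⟨-, hvs⟩ := padicValRat_shaAn_eq W p hLc hq hs
    have hx0 := coeffTwo_term_ne_zero W p hp2 Dm.isNewformOf hϖ hord
    have hexc' : (((ϖ : ℚ) : ℚ_[p]) * PowerSeries.coeff 2 L * padicLog p (cyclotomicGenerator p) ^ 2 *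
        (W.torsionOrder : ℚ_[p]) ^ 2).valuation =
        (LInvariant Dq * (W.tamagawaProduct : ℚ_[p]) * padicRegulator Dh).valuation + padicValRat p s := by
      rw [← hexc]; ring_nf
    exact ⟨ℒ, hℒ, hℒ0, q, hq, valuation_eq_of_rubinIdentity_of_certificate W p hx0 Dq hReg hℒ0 hval hexc' hvs⟩

end Summit.BirchSwinnertonDyer.BirchSwinnertonDyer.Theorems.EisensteinPrimesMazurMCOnCellBKatopointEquivalence

end
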